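/-
Copyright (c) 2026 the pub-hodgecm-mathlib formalisation cell (harness21).  Prover seat hodgecm-mathlib-F0P3a-p04 (g33); E1 keeper ∕ dealer F0P3a-p03 (g31) k75∕k84
2026-09-03T06:15Z, E1 BRICK LEDGER row 68-I «K4′-UNR ASSEMBLY HEAD» — the BINDER-FREE edition (v3) over ★ 73 + ★ 68-H + ★ (M5) + ★ (L) (keeper g32 k06 «one edition»; LEAD g16 T15-60 (A) head «=»).
-/
import Summits.HodgeConjecture.HodgeConjecture.Theorems.F0P3cStCharTSEPNormOneOfHsplit   -- ★ row 73 (LH5-p02 g12): §U′ `innerG_char_self_eq_one_of_hsplit_of_unramified` — EP-NORM-ONE from `hsplit`, junction letters (brings the whole ★ UNR cone: 59-F ED. 2, 58 FILE 1, 72∕72-NW, (G3), 41g-H, `Gqs`, `EllipticData`)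
import Summits.HodgeConjecture.HodgeConjecture.Theorems.F0P3cStCharTSLdsTwoOfTwo         -- ★ (F0P3b-p01) p852080: `exists_ne_of_card_two` (two distinct members from `card = 2`)
import Summits.HodgeConjecture.HodgeConjecture.Theorems.F0P3cStCharTSLdsSelfExtSplit     -- ★ row 68-H DATUM (F0P3b-p01 g26) p853797: `forall_smooth_selfExtension_split_of_mem_lds` — K4′ SPLIT @ DATUM (over ★ 68-H ABS p853780, ★ 68-A∕B∕C∕γ′, ★ 46‴, ★ (O1) 2b, ★ 68-R, ★ 63-D)
import Summits.HodgeConjecture.HodgeConjecture.Theorems.F0P3cStCharTSJetDatumHGL         -- ★ (M5) (F0P2-p06 g23): `hGLd_cmBorel` — the open-cell jet datum of every additive open-kernel `λ` on `T(L⁺_v)` (over ★ (O2) FILE B p853773 + ★ (O1)-D p853647)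
import Summits.HodgeConjecture.HodgeConjecture.Theorems.F0P3cStCharTSAdditiveCharLine    -- ★ 68-R ED. 2 (F0P2-p02 g28) p853791: (L) `additive_weylConj_eq_neg` (`λ ∘ Ad(w₀) = −λ`)
import Summits.HodgeConjecture.HodgeConjecture.Theorems.F0P3U3PrincipalSeriesOpenCellTorusChar  -- ★ `exists_weylElt_three` (the Weyl element `w₀` with matrix `Φ₃`)
import Summits.HodgeConjecture.HodgeConjecture.Theorems.F0P3cStCharTSWeylFixedIffNormTrivial   -- ★ `cmWeylTorusCharPair_eq_of_apply_fixed_eq_one` (case (3): `ʷθ̃ = θ̃`)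
import Literature.NumberTheory.Automorphic.CMPrincipalSeriesJacquetEvalOne                      -- ★ `continuous_cmTorusCharPair_apply`
import HarnessLib

/-!
# F0 · P3c · «StCharTS» K4′ column — E1 ROW 68-I «K4′-UNR ASSEMBLY HEAD»: `⟨χ_π, χ_π⟩_e = 1` for every member `π` of every l.d.s. `L`-packet `Π(θ) = JH(i_B(θ̃))` of `U(Φ₃)(L⁺_v)`,
# `v` non-split UNRAMIFIED — text 4 `hLdsOne` of the (S-𝔑) organ `hBlock′`, antecedents VERBATIM, ZERO hypothesis binders beyond the junction's letters

BINDER-FREE EDITION: every supplier ★ and consumed BY NAME (the HOME-only skeletons v1 2ae7353bd33d6e0c by paste ∕ v2 43d47d7e735cf086 by import, box GREEN F0P3a-p02 (g29), carried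
the ONE binder `hH68` until ★ 68-H DATUM p853797 + ★ (M5) + ★ (L) p853791; keeper g32 k06 «68-I waits and lands binder-free, one edition»).  Cell `pub/hodgecm-mathlib`, crux H413 =
`stmt-HodgeConjecture-24833` (`--supports … --as helper` lane); seat F0P3a-p04 (g33); keepers F0P3a-p03 (g31) k75∕k84∕k89 and (g32) k06∕k13∕k24; LEAD F0P3a-plan (g16) T15-54 (B) ∕
T15-60 (A) «=»: «organ-facing signature reads text 4 `hLdsOne`'s antecedents VERBATIM (`P ∈ 𝔇.ldsPackets`, `π ∈ P`, nothing else) under `(hns) (hunr)` + junction letters; NO `¬ sc`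
guard; GLUE G `hLdsOne ↦ hLdsOneNU`, token `IsUnramifiedIn`».  Census = CENSUS-R68 v1 607db827 (F0P3b-p01 (g26)) §1∕§3∕§5; residual certified = ∅ after (M5) (K4′ DOCK CERT v1∕v2,
LH5-p02 (g12)).  THEOREMS ONLY (no definition ∕ instance ∕ notation ∕ named fact ∕ `sorry`).

TARGET (text 4 = `hLdsOne` of (S-𝔑) `hBlock′`, served leaf ED. 34 :480–481, VERBATIM): `∀ P ∈ 𝔇.ldsPackets, ∀ π ∈ P, 𝔇.innerG (𝔇.char π) (𝔇.char π) = 1`.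

* INPUT ★ row 73 `Theorems/F0P3cStCharTSEPNormOneOfHsplit.lean` (LH5-p02 (g12), keeper k82∕k87): §U′ `innerG_char_self_eq_one_of_hsplit_of_unramified (hns) (hunr) «J» (r) (hsplit)` — EP-NORM-ONE
  @ UNR for every irreducible smooth `r` whose smooth self-extensions split (★ 58 S2b construction ∘ ★ 59-F ED. 2 §2 ∘ ★ (G3) letters-from-`hunr`), consumed BY NAME.
* §H THE HEAD `innerG_char_self_eq_one_of_mem_ldsPackets_of_unramified (hns) (hunr) ‹junction letters hC01 hC04 hC05 hE hchar› (hWIF hC1 hC2 hC3 hL2) (hLds : ‹field equation, organ :421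
  VERBATIM›) : ∀ P ∈ 𝔇.ldsPackets, ∀ π ∈ P, 𝔇.innerG (𝔇.char π) (𝔇.char π) = 1` — ZERO hypothesis binders.  Body: (S0) unpack `hLds` at `P` (`hcard χ₁ χ₂ hc1 hc2 htriv hne1 hmem`),
  `htwo := ★ exists_ne_of_card_two ⟨P, hcard, hmem⟩` — so NO `hLdsTwo`∕`hLdsRedTwo` organ letter is consumed (the packet ITSELF witnesses the two constituents: a SHRINK below T15-54 (B)'s
  allowance, keeper g31 k89), `hπc : π.IsConstituentOf (i_G(χ₁, χ₂))`; the (M5) letters at the datum — the Weyl element `w₀` with matrix `Φ₃` (★ `exists_weylElt_three`), continuity of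
  `θ̃ = cmTorusCharPair L v χ₁ χ₂` (★ `continuous_cmTorusCharPair_apply`), `ʷθ̃ = θ̃` in case (3) (★ `cmTorusCharPair_weylConj` + ★ `cmWeylTorusCharPair_eq_of_apply_fixed_eq_one … htriv`),
  the line `χL := 𝟙 ⊗ θ̃` (`Representation.twist_apply`) and (L) ★ `additive_weylConj_eq_neg L v w (hns w) w₀ hw₀`; representative `r` of `π`; **`hsplit := ★ 68-H
  F0P3cStCharTSLdsSelfExtSplit.forall_smooth_selfExtension_split_of_mem_lds L v hns χ₁ χ₂ hc1 hc2 htriv htwo (★ (M5) F0P3cStCharTSJetDatumHGL.hGLd_cmBorel L v hns w₀ hw₀ θ̃ hθc χL hχL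
  hθw (★ (L) …)) ⟦r⟧ hπc r rfl`** (every smooth self-extension of `r.ρ` splits — ★ 59-F :109–111's `hsplit` text at `r`); ONE call of ★ 73 §U′.
NO `μZ`∕`IsL2`∕`IsEllipticRep`∕unitarity letter; NO `¬ sc` guard (both members are case-(3) principal-series constituents by `hLds`).  GLUE (rider pen, ED. 37):
`hLdsOneUnr := fun hunr => F0P3cStCharTSK4PrimeUnr.innerG_char_self_eq_one_of_mem_ldsPackets_of_unramified L v hns hunr νQv mQv hcanQ 𝔇 hC01 hC04 hC05 hE hchar hWIF hC1 hC2 hC3 hL2allcert hLdsF`.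
HONEST LABEL: count-neutral helper (rider-class: text 4 `hLdsOne` [Rogawski1990 §12.6 Prop. 12.6.1 (a) p. 188] at an UNRAMIFIED place is now a THEOREM over ★ inputs + the junction's own
field equation; it RIDES only when the LEAD cuts ED. 37 — insert-only `¬ Algebra.IsUnramifiedIn (𝓞 L) v.asIdeal →` on `hLdsOne`, token `IsUnramifiedIn`); E1 = PRINT until then; h413 OPEN; HC_CM is proved only modulo the 7 printed citations (2 remaining named inputs hLiu418 = stmt-HodgeConjecture-24832, h413 =
stmt-HodgeConjecture-24833) until rung 0 closes.  Nothing printed is asserted here.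

## References
* [Rogawski1990] J. D. Rogawski, *Automorphic Representations of Unitary Groups in Three Variables*, Ann. of Math. Stud. 123 (1990), §12.2 (3) pp. 173–174, §12.5 pp. 182–187, §12.6 Prop. 12.6.1 (a) p. 188.
* [SchneiderStuhler1997] P. Schneider, U. Stuhler, *Representation theory and sheaves on the Bruhat–Tits building*, Publ. Math. IHÉS 85 (1997), §III.4.
* [Kottwitz1988] R. Kottwitz, *Tamagawa numbers*, Ann. of Math. 127 (1988), §2.
* [Keys1984] D. Keys, *Principal series representations of special unitary groups over local fields*, Compositio Math. 51 (1984), §3–§4, §7 Thm. p. 126.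
-/

set_option autoImplicit false
-- the mandated namespace has the single-problem summit's repeated segment (`HodgeConjecture.HodgeConjecture`)
set_option linter.dupNamespace false

noncomputable section

open NumberField IsDedekindDomain MeasureTheory Filter Topology
open scoped Matrix MatrixGroups Pointwise Valued WithZero ComplexConjugate
open Literature.NumberTheory.Rogawski1990 Literature.NumberTheory.Rogawski1990.Ch12Sec5
open Literature.NumberTheory.Automorphic Literature.NumberTheory.Automorphic.UnitaryGroup Literature.NumberTheory.Automorphic.UnitaryLatticeTree
open Literature.NumberTheory.Automorphic.HermitianLattice
open Literature.NumberTheory.GaloisRepresentations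

namespace Summit.HodgeConjecture.HodgeConjecture.Cruxes.H413.F0P3cStCharTSK4PrimeUnr

open Summit.HodgeConjecture.HodgeConjecture.Cruxes.H413
open Summit.HodgeConjecture.HodgeConjecture.Cruxes.H413.F0P3cStCharTSTorusDefs

variable (L : Type) [Field L] [NumberField L] [IsCMField L] (v : HeightOneSpectrum (𝓞 ↥(maximalRealSubfield L)))

/-! ## ROW 68-I «K4′-UNR ASSEMBLY HEAD»: text 4 `hLdsOne` at an UNRAMIFIED place, antecedents VERBATIM, junction letters + `hLds`, ZERO hypothesis binders -/

section Head

set_option maxHeartbeats 400000 in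
-- ONE disclosed budget (2× default; measured FAIL 200000 ∕ PASS 400000, file wall ≈ 24 s) for the ONE carrier-crossing `isDefEq` of this file: docking ★ (M5) `hGLd_cmBorel …`'s conclusion (`χL`-abstract, `↥(unitaryGroupOfForm …)` spelling)
-- into ★ 68-H's `hGLd` binder (`𝟙.twist θ̃` expanded, `Gqs L v` spelling) — measured: the default 200000 times out at that `exact`; the head itself elaborated at DEFAULT in skeletons v1∕v2
/-- **ROW 68-I «K4′-UNR ASSEMBLY HEAD» — `⟨χ_π, χ_π⟩_e = 1` FOR EVERY MEMBER OF EVERY L.D.S. PACKET, `v` UNRAMIFIED (binder-free).**  At a non-split place `v` UNRAMIFIED in `L` (`hunr`), at a §12.5 datum `𝔇` with the junction pins `hμG horb hreg hE hM1`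
(`hC01 hC04 hC05 hE hchar`), ★ PCT-OUT's `hWIF hC1 hC2 hC3 hL2` and the l.d.s. FIELD EQUATION `hLds` (junction letter `hLdsF`, organ :421 VERBATIM): **for every l.d.s. packet `P ∈ 𝔇.ldsPackets` and
every member `π ∈ P`, `⟨χ_π, χ_π⟩_e = 1`** — text 4 `hLdsOne` of (S-𝔑) `hBlock′` with its antecedents VERBATIM (`P ∈ 𝔇.ldsPackets`, `π ∈ P`, nothing else; NO `¬ sc` guard), ZERO
hypothesis binders beyond the junction's letters.  Proof: (S0) unpack `hLds` at `P`; the packet itself gives the two distinct constituents (`htwo`, ★ `exists_ne_of_card_two` — no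
`hLdsTwo`∕`hLdsRedTwo` letter consumed); `π` is a constituent; the (M5) letters `w₀ hw₀ hθc hχL hθw` + ★ (L) at the datum; representative `r`; `hsplit := ★ 68-H
`F0P3cStCharTSLdsSelfExtSplit.forall_smooth_selfExtension_split_of_mem_lds` (K4′ SPLIT @ DATUM) fed `hGLd := ★ (M5) F0P3cStCharTSJetDatumHGL.hGLd_cmBorel … (★ (L) additive_weylConj_eq_neg …)`;
ONE call of ★ row 73 §U′ `F0P3cStCharTSEPNormOneOfHsplit.innerG_char_self_eq_one_of_hsplit_of_unramified`.  Rides on the LEAD's ED. 37 cut (rule 25∕26: token `IsUnramifiedIn`, GLUE G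
`hLdsOne ↦ hLdsOneNU`).
[cite: Rogawski1990, §12.6 Prop. 12.6.1 (a) p. 188; §12.2 (3) pp. 173–174] [cite: SchneiderStuhler1997, §III.4] [cite: Kottwitz1988, §2] [cite: Keys1984, §7 Thm. p. 126] -/
theorem innerG_char_self_eq_one_of_mem_ldsPackets_of_unramified
    (hns : ∀ w : PlacesOver L v, IsCMField.complexConj L • w.1 = w.1) (hunr : Algebra.IsUnramifiedIn (𝓞 L) v.asIdeal)
    [MeasurableSpace (Gqs L v)] [BorelSpace (Gqs L v)]
    [∀ γ : Gqs L v, MeasurableSpace (Gqs L v ⧸ Subgroup.centralizer ({γ} : Set (Gqs L v)))] [∀ γ : Gqs L v, BorelSpace (Gqs L v ⧸ Subgroup.centralizer ({γ} : Set (Gqs L v)))]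
    [MeasurableSpace (Gqs L v ⧸ Subgroup.center (Gqs L v))]
    {H : Type} [Group H] [TopologicalSpace H] [IsTopologicalGroup H] [MeasurableSpace H]
    (νQv : Measure (Gqs L v)) [νQv.IsHaarMeasure] [νQv.IsMulRightInvariant] (mQv : OrbitalMeasureFamily (Gqs L v))
    (hcanQ : mQv.IsCanonical (fun γ => IsRegularElt (γ.val : GL (Fin 3) (UnitaryGroup.LocalRing L v))) νQv)
    (𝔇 : EllipticData (Gqs L v) H) (hμG : 𝔇.μG = νQv) (horb : 𝔇.orb = mQv)
    (hreg : ∀ γ : Gqs L v, γ ∈ 𝔇.regG ↔ IsRegularElt (γ.val : GL (Fin 3) (UnitaryGroup.LocalRing L v)))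
    (hE : ∀ γ : Gqs L v, γ ∈ 𝔇.ellG ↔ IsRegularElt (γ.val : GL (Fin 3) (UnitaryGroup.LocalRing L v)) ∧ γ ∉ hyperbolicSet L v)
    (hM1 : ∀ π : IrrClass (Gqs L v), Measurable (𝔇.char π) ∧ LocallyIntegrable (𝔇.char π) 𝔇.μG ∧ (∀ x ∈ 𝔇.regG, ∀ᶠ y in 𝓝 x, 𝔇.char π y = 𝔇.char π x) ∧
      ∀ φ : Gqs L v → ℂ, IsLocSmooth φ → π.smoothTrace 𝔇.μG φ = ∫ x, φ x * 𝔇.char π x ∂𝔇.μG)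
    (hWIF : 𝔇.WeylIntegrationFormula) (hC1 : 𝔇.EllCartanSubset) (hC2 : 𝔇.EllCartanAE) (hC3 : 𝔇.NonEllCartanAE) (hL2 : 𝔇.L2CharOnTorusAll)   -- ★ PCT-OUT's extra letters
    -- hLdsF — the l.d.s. FIELD EQUATION (junction letter; organ (S-𝔑) :421 VERBATIM)
    (hLds : ∀ P : Finset (IrrClass (Gqs L v)), P ∈ 𝔇.ldsPackets ↔ (P.card = 2 ∧ ∃ (χ₁ : (UnitaryGroup.LocalRing L v)ˣ →* ℂˣ) (χ₂ : ↥(normOneUnits (conjLocal L (IsCMField.complexConj L) v)) →* ℂˣ), Continuous (fun x => ((χ₁ x : ℂˣ) : ℂ)) ∧ Continuous (fun x => ((χ₂ x : ℂˣ) : ℂ)) ∧ (∀ a : (UnitaryGroup.LocalRing L v)ˣ, (conjLocal L (IsCMField.complexConj L) v) (a : UnitaryGroup.LocalRing L v) = a → χ₁ a = 1) ∧ χ₁ ≠ 1 ∧ ∀ c : IrrClass (Gqs L v), c ∈ P ↔ c.IsConstituentOf (UnitaryGroup.cmPrincipalSeries L 3 v (UnitaryGroup.cmTorusCharPair L v χ₁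 χ₂))))
    :
    ∀ P ∈ 𝔇.ldsPackets, ∀ π ∈ P, 𝔇.innerG (𝔇.char π) (𝔇.char π) = 1 := by
  intro P hP π hπ
  -- (S0) unpack the field equation at `P`: the packet is `JH(i_G(χ₁, χ₂))` in case (3); its two members ARE the two distinct constituents; `π` is a constituent
  obtain ⟨hcard, χ₁, χ₂, hc1, hc2, htriv, -, hmem⟩ := (hLds P).1 hP
  have htwo : ∃ c₁ c₂ : IrrClass (Gqs L v), c₁ ≠ c₂ ∧ c₁.IsConstituentOf (UnitaryGroup.cmPrincipalSeries L 3 v (UnitaryGroup.cmTorusCharPair L v χ₁ χ₂)) ∧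
      c₂.IsConstituentOf (UnitaryGroup.cmPrincipalSeries L 3 v (UnitaryGroup.cmTorusCharPair L v χ₁ χ₂)) :=
    F0P3cStCharTSLdsTwoOfTwo.exists_ne_of_card_two ⟨P, hcard, hmem⟩
  have hπc : π.IsConstituentOf (UnitaryGroup.cmPrincipalSeries L 3 v (UnitaryGroup.cmTorusCharPair L v χ₁ χ₂)) := (hmem π).1 hπ
  clear hπ hmem
  -- the (M5) letters at the datum: the Weyl element `w₀` (matrix `Φ₃`), continuity of `θ̃`, `ʷθ̃ = θ̃` (case (3), `htriv`), the line `χL := 𝟙 ⊗ θ̃`, and (L) `λ ∘ Ad(w₀) = −λ`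
  obtain ⟨w₀, hw₀⟩ := F0P3U3PrincipalSeriesOpenCellTorusChar.exists_weylElt_three L v hns
  have hθc : Continuous fun t => ((cmTorusCharPair L v χ₁ χ₂ t : ℂˣ) : ℂ) := continuous_cmTorusCharPair_apply L v χ₁ χ₂ hc1 hc2
  have hθw : ∀ m : ↥(cmBorelTriple L 3 v).M,
      cmTorusCharPair L v χ₁ χ₂ ⟨w₀ * (m : ↥(unitaryGroupOfForm (conjLocal L (IsCMField.complexConj L) v) (cmLocalForm L 3 v))) * w₀⁻¹, weylConj_mem_cmTorus L v w₀ hw₀ m⟩ =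
        cmTorusCharPair L v χ₁ χ₂ m := fun m => by
    rw [cmTorusCharPair_weylConj L v w₀ hw₀, F0P3cStCharTSWeylFixedIffNormTrivial.cmWeylTorusCharPair_eq_of_apply_fixed_eq_one L v χ₁ χ₂ htriv]
  have hχL : ∀ (m : ↥(cmBorelTriple L 3 v).M) (x : ℂ),
      ((Representation.trivial ℂ ↥(cmBorelTriple L 3 v).M ℂ).twist (cmTorusCharPair L v χ₁ χ₂)) m x = (cmTorusCharPair L v χ₁ χ₂ m : ℂ) * x := fun m x => by
    simp [Representation.twist_apply]
  obtain ⟨w⟩ : Nonempty (PlacesOver L v) := inferInstance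
  -- a representative `r` of `π`; `hsplit := ★ 68-H (K4′ SPLIT @ DATUM) fed ★ (M5) + ★ (L)`; ONE call of ★ row 73 §U′
  induction π using IrrClass.ind with
  | h r =>
  exact F0P3cStCharTSEPNormOneOfHsplit.innerG_char_self_eq_one_of_hsplit_of_unramified L v hns hunr νQv mQv hcanQ 𝔇 hμG horb hreg hE hM1 hWIF hC1 hC2 hC3 hL2 r
    (F0P3cStCharTSLdsSelfExtSplit.forall_smooth_selfExtension_split_of_mem_lds L v hns χ₁ χ₂ hc1 hc2 htriv htwo
      (F0P3cStCharTSJetDatumHGL.hGLd_cmBorel L v hns w₀ hw₀ (cmTorusCharPair L v χ₁ χ₂) hθc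
        ((Representation.trivial ℂ ↥(cmBorelTriple L 3 v).M ℂ).twist (cmTorusCharPair L v χ₁ χ₂)) hχL hθw
        (F0P3cStCharTSAdditiveCharLine.additive_weylConj_eq_neg L v w (hns w) w₀ hw₀))
      (IrrClass.mk r) hπc r rfl)

end Head

end Summit.HodgeConjecture.HodgeConjecture.Cruxes.H413.F0P3cStCharTSK4PrimeUnr

end
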